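import Literature.Topology.FourManifolds.BandCore
import Mathlib.Analysis.SpecialFunctions.SmoothTransition
import Mathlib.Analysis.Calculus.Deriv.Basic
import HarnessLib

/-!
# Constants of the slide by compactness: bounds of the strip rate, the slice angle and the smooth transition

Topic `Literature/Topology/FourManifolds`; fact seat `provefact-IsStrictHandleSlide.isSurgery`
(R. C. Kirby, *The Topology of 4-Manifolds*, LNM 1374 (1989), Ch. I §4, Fig. 4.2; remaining content:
the named fact (S) `Literature.Topology.FourManifolds.FramedLink.IsStrictHandleSlide.slideModel`).
The quantitative hypotheses `RouteHyp`, `FingerHyp`, `K1Loop2Data` of the route/fingertip analysis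
ask for explicit bounds: `e₋ ≤ e ≤ e₊`, `|e'| ≤ Me` for the strip rate; `-MΘ ≤ Θ' ≤ -mΘ < 0` for the
slice angle `Θ = 2π·thetaB - φ`; and a bound `C_T` of the derivative of `Real.smoothTransition`.
This file provides them by compactness:

* `exists_bounds_pos_of_continuousOn`, `exists_abs_le_of_continuousOn` — generic bounds on `[a, b]`;
* `exists_smoothTransition_deriv_le` — `∃ C_T ≥ 0, smoothTransition' ≤ C_T` everywhere;
* `exists_rate_bounds` — the four constants of a rate smooth and positive on `(1/10, 9/10)`, on a
  compact sub-window;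
* `BandCore.exists_angle_bounds` — `mΘ, MΘ` for `2π·thetaB` on a compact sub-window
  (`BandCore.deriv_thetaB_neg`, `contDiffAt_thetaB`).

## References

* R. C. Kirby, *The Topology of 4-Manifolds*, LNM 1374, Springer (1989), Ch. I §4. [Kirby1989]
-/

open scoped ContDiff Topology
open Set Real Filter

noncomputable section

namespace Literature.Topology.FourManifolds

/-- A continuous positive function on `[a, b]` has positive lower and upper bounds. [folklore] -/
theorem exists_bounds_pos_of_continuousOn {f : ℝ → ℝ} {a b : ℝ} (hab : a ≤ b) (hc : ContinuousOn f (Icc a b))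
    (hpos : ∀ x ∈ Icc a b, 0 < f x) : ∃ m M : ℝ, 0 < m ∧ m ≤ M ∧ ∀ x ∈ Icc a b, m ≤ f x ∧ f x ≤ M := by
  have hne : (Icc a b).Nonempty := nonempty_Icc.2 hab
  obtain ⟨x₀, hx₀, hmin⟩ := (isCompact_Icc (a := a) (b := b)).exists_isMinOn hne hc
  obtain ⟨x₁, hx₁, hmax⟩ := (isCompact_Icc (a := a) (b := b)).exists_isMaxOn hne hc
  refine ⟨f x₀, f x₁, hpos x₀ hx₀, ?_, fun x hx ↦ ⟨hmin hx, hmax hx⟩⟩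
  exact hmin hx₁

/-- A continuous function on `[a, b]` is bounded in absolute value by a nonnegative constant. [folklore] -/
theorem exists_abs_le_of_continuousOn {f : ℝ → ℝ} {a b : ℝ} (hc : ContinuousOn f (Icc a b)) :
    ∃ M : ℝ, 0 ≤ M ∧ ∀ x ∈ Icc a b, |f x| ≤ M := by
  obtain ⟨M, hM⟩ := (isCompact_Icc (a := a) (b := b)).exists_bound_of_continuousOn hc
  refine ⟨max M 0, le_max_right _ _, fun x hx ↦ ?_⟩
  have := hM x hx
  rw [Real.norm_eq_abs] at this
  exact this.trans (le_max_left _ _)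

/-- **A global bound of the derivative of the smooth transition.** [folklore] -/
theorem exists_smoothTransition_deriv_le : ∃ C : ℝ, 0 ≤ C ∧ ∀ x, deriv Real.smoothTransition x ≤ C := by
  have hcont : Continuous (deriv Real.smoothTransition) :=
    (Real.smoothTransition.contDiff (n := 2)).continuous_deriv (by norm_num)
  obtain ⟨M, hM0, hM⟩ := exists_abs_le_of_continuousOn (a := 0) (b := 1) hcont.continuousOn
  refine ⟨M, hM0, fun x ↦ ?_⟩
  by_cases hx : x ∈ Icc (0 : ℝ) 1
  · exact (le_abs_self _).trans (hM x hx)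
  · -- outside `[0, 1]` the transition is locally constant
    have hd : deriv Real.smoothTransition x = 0 := by
      rw [mem_Icc, not_and_or, not_le, not_le] at hx
      rcases hx with h | h
      · have hev : Real.smoothTransition =ᶠ[𝓝 x] fun _ ↦ (0 : ℝ) :=
          Filter.eventuallyEq_of_mem (Iio_mem_nhds h) fun z hz ↦ Real.smoothTransition.zero_of_nonpos (le_of_lt hz)
        rw [hev.deriv_eq, deriv_const]
      · have hev : Real.smoothTransition =ᶠ[𝓝 x] fun _ ↦ (1 : ℝ) :=
          Filter.eventuallyEq_of_mem (Ioi_mem_nhds h) fun z hz ↦ Real.smoothTransition.one_of_one_le (le_of_lt hz)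
        rw [hev.deriv_eq, deriv_const]
    rw [hd]; exact hM0

/-- **Bounds of a rate smooth and positive on `(1/10, 9/10)`** on a compact sub-window `[w₁, w₂]`:
`0 < e₋ ≤ e ≤ e₊` and `|e'| ≤ Me` there. [folklore] -/
theorem exists_rate_bounds {e : ℝ → ℝ} (he : ContDiffOn ℝ ∞ e (Ioo (10⁻¹ : ℝ) (9 / 10)))
    (hpos : ∀ h ∈ Ioo (10⁻¹ : ℝ) (9 / 10), 0 < e h) {w₁ w₂ : ℝ} (hw₁ : 10⁻¹ < w₁) (hw : w₁ ≤ w₂) (hw₂ : w₂ < 9 / 10) :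
    ∃ emin emax Me : ℝ, 0 < emin ∧ emin ≤ emax ∧ 0 ≤ Me ∧
      (∀ h ∈ Icc w₁ w₂, emin ≤ e h ∧ e h ≤ emax) ∧ (∀ h ∈ Icc w₁ w₂, |deriv e h| ≤ Me) := by
  have hsub : Icc w₁ w₂ ⊆ Ioo (10⁻¹ : ℝ) (9 / 10) := fun h hh ↦ ⟨hw₁.trans_le hh.1, hh.2.trans_lt hw₂⟩
  have hc : ContinuousOn e (Icc w₁ w₂) := he.continuousOn.mono hsub
  obtain ⟨m, M, hm, hmM, hb⟩ := exists_bounds_pos_of_continuousOn hw hc fun h hh ↦ hpos h (hsub hh)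
  have hdc : ContinuousOn (deriv e) (Icc w₁ w₂) :=
    (he.continuousOn_deriv_of_isOpen isOpen_Ioo (by simp)).mono hsub
  obtain ⟨Me, hMe0, hMe⟩ := exists_abs_le_of_continuousOn hdc
  exact ⟨m, M, Me, hm, hmM, hMe0, hb, hMe⟩

namespace BandCore

variable {A B : Knot} {avoid : Set (Metric.sphere (0 : EuclideanSpace ℝ (Fin 4)) 1)} (c : BandCore A B avoid)

/-- `thetaB` is `C^∞` on the open window. [folklore] -/
theorem contDiffOn_thetaB : ContDiffOn ℝ ∞ c.thetaB (Ioo (10⁻¹ : ℝ) (9 / 10)) :=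
  fun _ hy ↦ (c.contDiffAt_thetaB hy).contDiffWithinAt

/-- **Bounds of the slice angle rate** `Θ = 2π·thetaB` on a compact sub-window: `-MΘ ≤ Θ' ≤ -mΘ < 0`.
[folklore] -/
theorem exists_angle_bounds {w₁ w₂ : ℝ} (hw₁ : 10⁻¹ < w₁) (hw : w₁ ≤ w₂) (hw₂ : w₂ < 9 / 10) :
    ∃ mΘ MΘ : ℝ, 0 < mΘ ∧ mΘ ≤ MΘ ∧
      ∀ h ∈ Icc w₁ w₂, -MΘ ≤ deriv (fun y ↦ 2 * π * c.thetaB y) h ∧ deriv (fun y ↦ 2 * π * c.thetaB y) h ≤ -mΘ := by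
  have hsub : Icc w₁ w₂ ⊆ Ioo (10⁻¹ : ℝ) (9 / 10) := fun h hh ↦ ⟨hw₁.trans_le hh.1, hh.2.trans_lt hw₂⟩
  -- `-(2π thetaB)'` is continuous and positive on the compact window
  have hderiv : ∀ h ∈ Ioo (10⁻¹ : ℝ) (9 / 10), deriv (fun y ↦ 2 * π * c.thetaB y) h = 2 * π * deriv c.thetaB h := by
    intro h hh
    exact ((c.contDiffAt_thetaB hh).differentiableAt (by simp)).hasDerivAt.const_mul (2 * π) |>.deriv
  have hdc : ContinuousOn (fun h ↦ -(2 * π * deriv c.thetaB h)) (Icc w₁ w₂) := by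
    have := (c.contDiffOn_thetaB.continuousOn_deriv_of_isOpen isOpen_Ioo (by simp)).mono hsub
    exact (this.const_smul (2 * π)).neg.congr fun h _ ↦ by simp [smul_eq_mul]
  have hpos : ∀ h ∈ Icc w₁ w₂, 0 < -(2 * π * deriv c.thetaB h) := by
    intro h hh
    have := c.deriv_thetaB_neg (hsub hh)
    nlinarith [pi_pos]
  obtain ⟨m, M, hm, hmM, hb⟩ := exists_bounds_pos_of_continuousOn hw hdc hpos
  refine ⟨m, M, hm, hmM, fun h hh ↦ ?_⟩
  rw [hderiv h (hsub hh)]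
  have := hb h hh
  exact ⟨by linarith [this.2], by linarith [this.1]⟩

end BandCore

end Literature.Topology.FourManifolds
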